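import Mathlib

/-!
# Tier 3, T3.2 — (R2) ∧ (R1), the pinning: the finite bookkeeping on the kernel (seat t3-p3)

Blind re-derivation cell `pub-hodge-repro`, Tier-3 seat `t3-p3` (route/TIER3.md v0.1 §2, T3.2;
paper: proofs/t3-p3/R2-PINNING.md). The endoscopic criterion for the period crux (P) at p = 2 ends
in two conditions on four self-dual Hecke characters `χ_j′` of the CM field `E′` (ROUTE.md §4 item 2
(8)–(9)): **(R1)** the four global root numbers are `+1`, **(R2)** the four central values
`L(½, χ_j′)` are non-zero — with the freedom to twist each `χ_j′` by a finite-order anticyclotomic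
character `η_j`, subject to the central-character condition N2: `η_0 η_1 = η_2 η_3`.

This file holds the elementary set-theoretic / group-theoretic steps of that bookkeeping:

* `exists_common_of_cofinite` / `infinite_iInter_of_cofinite` — finitely many COFINITE subsets of an
  infinite set meet in an infinite (cofinite) set: the step «cofinite ∩ cofinite» that turns a
  per-character cofinite non-vanishing theorem (BHTY Theorem 1.1, along a split-𝔭 anticyclotomic
  family `Ξ_𝔭 ≃ characters of ℤ_p^{deg 𝔭}`, infinite) into ONE common twist `ν` for all four
  characters (R2-PINNING.md §4).
* `even_sign_pattern_fix` — (S3): an EVEN sign pattern `ε : Fin 4 → ℤˣ` (`ε 0 * ε 1 = ε 2 * ε 3`, which is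
  (E3)-global) is cancelled by a quadratic-twist pattern `q` that is N2-compatible (`q 0 * q 1 = q 2 * q 3`):
  every even pattern is moved to `(+,+,+,+)` without breaking N2.
* `existsUnique_n2_extension` / `const_n2` — the N2-admissible twist vectors (`η 0 * η 1 = η 2 * η 3`) form the
  3-parameter family `(η_0, η_1, η_2, η_0 η_1 η_2⁻¹)`: the fourth twist is determined by the other three; the
  constant vector `(ν,ν,ν,ν)` is admissible (R2-PINNING.md §2.2).
* `pinning_of_cofinite` — the abstract form of R2-PINNING.md §4: four cofinite «good» sets in an
  infinite twist group give infinitely many `ν` whose constant vector is good and N2-admissible.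
* `exists_infinite_disjoint` — the trivial reason the lead's decoupling does not run on
  «infinitely many per character» alone: two infinite subsets of an infinite set may be disjoint
  (R2-PINNING.md §2.3; BHTY p0035:L26 says the same about the anticyclotomic sets).

What stays on paper: everything arithmetic — the identification of the four characters, the
self-duality and the sign constancy along a split-𝔭 family (BHTY p0034:L74), BHTY Theorem 1.1
itself (a 2025 preprint: RESIDUAL R-B of TIER3.md §3).

Nothing here says anything about the status of the Hodge conjecture for CM abelian varieties.
-/

set_option autoImplicit false

noncomputable section

namespace Summit.Ventures.HodgeRepro.T3.R2Pinning

open Set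

section Cofinite

variable {α ι : Type*}

/-- Finitely many cofinite subsets have a cofinite intersection. -/
theorem finite_compl_iInter [Finite ι] (s : ι → Set α) (h : ∀ i, (s i)ᶜ.Finite) :
    (⋂ i, s i)ᶜ.Finite := by
  rw [Set.compl_iInter]
  exact Set.finite_iUnion h

/-- In an infinite type, finitely many cofinite subsets have an infinite intersection. -/
theorem infinite_iInter_of_cofinite [Infinite α] [Finite ι] (s : ι → Set α)
    (h : ∀ i, (s i)ᶜ.Finite) : (⋂ i, s i).Infinite :=
  Set.infinite_of_finite_compl (finite_compl_iInter s h)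

/-- **The common twist exists**: finitely many cofinite subsets of an infinite type have a common
element (indeed infinitely many). -/
theorem exists_common_of_cofinite [Infinite α] [Finite ι] (s : ι → Set α)
    (h : ∀ i, (s i)ᶜ.Finite) : ∃ a, ∀ i, a ∈ s i := by
  obtain ⟨a, ha⟩ := (infinite_iInter_of_cofinite s h).nonempty
  exact ⟨a, Set.mem_iInter.mp ha⟩

end Cofinite

section Signs

/-- **(S3) Every even sign pattern is cancelled N2-compatibly.** If the four root numbers satisfy
`ε 0 * ε 1 = ε 2 * ε 3` ((E3)-global), then twisting line `j` by a quadratic character exactly when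
`ε j = -1` (the pattern `q := ε`) keeps N2 (`q 0 * q 1 = q 2 * q 3`) and makes every sign `+1`. -/
theorem even_sign_pattern_fix (ε : Fin 4 → ℤˣ) (h : ε 0 * ε 1 = ε 2 * ε 3) :
    ∃ q : Fin 4 → ℤˣ, q 0 * q 1 = q 2 * q 3 ∧ ∀ j, ε j * q j = 1 :=
  ⟨ε, h, fun j => Int.units_mul_self (ε j)⟩

/-- Conversely, an N2-compatible twist pattern can only cancel an EVEN pattern: the product of the
four signs is invariant. -/
theorem even_of_fix (ε q : Fin 4 → ℤˣ) (hq : q 0 * q 1 = q 2 * q 3) (h : ∀ j, ε j * q j = 1) :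
    ε 0 * ε 1 = ε 2 * ε 3 := by
  -- in `ℤˣ` every element is its own inverse: `ε j = q j`
  have e : ∀ j, ε j = q j := fun j => by
    have := h j
    calc ε j = ε j * (q j * q j) := by rw [Int.units_mul_self, mul_one]
      _ = (ε j * q j) * q j := by rw [mul_assoc]
      _ = q j := by rw [this, one_mul]
  rw [e 0, e 1, e 2, e 3]
  exact hq

end Signs

section N2

variable {Ξ : Type*} [CommGroup Ξ]

/-- The constant vector `(ν, ν, ν, ν)` is N2-admissible: `η 0 * η 1 = η 2 * η 3`. -/
theorem const_n2 (ν : Ξ) : (fun _ : Fin 4 => ν) 0 * (fun _ : Fin 4 => ν) 1 =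
    (fun _ : Fin 4 => ν) 2 * (fun _ : Fin 4 => ν) 3 := rfl

/-- **The 3-parameter family.** For every choice of three twists `(η_0, η_1, η_2)` there is exactly one
N2-admissible vector `η` (`η 0 * η 1 = η 2 * η 3`) extending it: the fourth twist `η_3 = η_0 η_1 η_2⁻¹`
is determined by the other three. -/
theorem existsUnique_n2_extension (x : Fin 3 → Ξ) :
    ∃! η : Fin 4 → Ξ, (∀ i : Fin 3, η (Fin.castSucc i) = x i) ∧ η 0 * η 1 = η 2 * η 3 := by
  refine ⟨![x 0, x 1, x 2, x 0 * x 1 * (x 2)⁻¹], ⟨?_, ?_⟩, ?_⟩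
  · intro i
    fin_cases i <;> rfl
  · show x 0 * x 1 = x 2 * (x 0 * x 1 * (x 2)⁻¹)
    rw [mul_comm (x 2) _, inv_mul_cancel_right]
  · rintro η ⟨hx, hn⟩
    ext i
    fin_cases i
    · exact hx 0
    · exact hx 1
    · exact hx 2
    · show η 3 = x 0 * x 1 * (x 2)⁻¹
      rw [← hx 0, ← hx 1, ← hx 2]
      change η 3 = η 0 * η 1 * (η 2)⁻¹
      rw [hn]
      exact (mul_inv_cancel_comm _ _).symm

end N2

section Pinning

variable {Ξ : Type*} [CommGroup Ξ]

/-- **The abstract pinning (R2-PINNING.md §4).** `Ξ` = the twist group (a split-𝔭 anticyclotomic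
family, infinite); `C j` = the twists `ν` for which the `j`-th central value `L(1, λ_j ν)` is non-zero
AND the sign is `+1` — cofinite by the one-value + Katz + Weierstrass chain (the arithmetic input, on
paper). Then infinitely many `ν` are good for all four characters at once, and the constant twist
vector `(ν, ν, ν, ν)` satisfies N2 (`η 0 * η 1 = η 2 * η 3`): (R2) ∧ (R1) with ONE common twist. -/
theorem pinning_of_cofinite [Infinite Ξ] (C : Fin 4 → Set Ξ) (hC : ∀ j, (C j)ᶜ.Finite) :
    {ν : Ξ | ∀ j, ν ∈ C j}.Infinite ∧
      ∀ ν ∈ {ν : Ξ | ∀ j, ν ∈ C j}, ∀ η : Fin 4 → Ξ, (∀ j, η j = ν) → η 0 * η 1 = η 2 * η 3 := by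
  refine ⟨?_, fun ν _ η hη => by rw [hη 0, hη 1, hη 2, hη 3]⟩
  have h := infinite_iInter_of_cofinite C hC
  convert h using 1
  ext ν
  simp

/-- **Why «infinitely many per character» is not enough (R2-PINNING.md §2.3):** two infinite subsets
of an infinite set can be disjoint — e.g. the even and the odd integers. -/
theorem exists_infinite_disjoint :
    ∃ A B : Set ℤ, A.Infinite ∧ B.Infinite ∧ A ∩ B = ∅ := by
  refine ⟨Set.range (fun n : ℕ => (2 * n : ℤ)), Set.range (fun n : ℕ => (2 * n + 1 : ℤ)),
    Set.infinite_range_of_injective (fun a b h => by simpa using h),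
    Set.infinite_range_of_injective (fun a b h => by simpa using h), ?_⟩
  ext x
  simp only [Set.mem_inter_iff, Set.mem_range, Set.mem_empty_iff_false, iff_false, not_and]
  rintro ⟨a, rfl⟩ ⟨b, hb⟩
  omega

end Pinning

section EulerFactor

/-- **Lemma E, the algebraic half (R2-PINNING.md §9(3)).** The unramified modified Euler factor of
Hsieh 2014 p0014:L53–56, `χ_w(2δ_w)·(1 − χ_w(ϖ)⁻¹ q⁻¹)/(1 − χ_w(ϖ))`, is non-zero as soon as
`|χ_w(ϖ)|² · q = 1` with `q > 1` — the purity of the infinity type (`|χ_w(ϖ)| = q^{−1/2}`, on paper) —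
and the unit `χ_w(2δ_w) ≠ 0`: neither `χ_w(ϖ)` nor `χ_w(ϖ)⁻¹ q⁻¹` equals `1`. -/
theorem euler_factor_ne_zero {a u : ℂ} {q : ℝ} (hq : 1 < q) (ha : ‖a‖ ^ 2 * q = 1) (hu : u ≠ 0) :
    u * (1 - a⁻¹ * (q : ℂ)⁻¹) / (1 - a) ≠ 0 := by
  have hq0 : (0 : ℝ) < q := by linarith
  have ha0 : a ≠ 0 := by
    rintro rfl
    simp at ha
  -- `1 - a ≠ 0`: otherwise `‖a‖ = 1` and `q = 1`
  have h1 : 1 - a ≠ 0 := by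
    intro h
    have : a = 1 := by linear_combination -h
    rw [this, norm_one, one_pow, one_mul] at ha
    linarith
  -- `1 - a⁻¹ q⁻¹ ≠ 0`: otherwise `a = q⁻¹`, so `‖a‖² q = q⁻¹ = 1`, i.e. `q = 1`
  have h2 : 1 - a⁻¹ * (q : ℂ)⁻¹ ≠ 0 := by
    intro h
    have hq0' : (q : ℂ) ≠ 0 := by exact_mod_cast hq0.ne'
    have hinv : a⁻¹ * (q : ℂ)⁻¹ = 1 := by linear_combination -h
    have haq : a = (q : ℂ)⁻¹ := by
      field_simp at hinv
      exact eq_inv_of_mul_eq_one_left hinv.symm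
    rw [haq, norm_inv, Complex.norm_real, Real.norm_eq_abs, abs_of_pos hq0] at ha
    field_simp at ha
    nlinarith
  exact div_ne_zero (mul_ne_zero hu h2) h1

end EulerFactor

end Summit.Ventures.HodgeRepro.T3.R2Pinning
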